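import Summits.HubbardSuperconductivity.HubbardSuperconductivity.Theorems.JosephsonMirrorJmCuspGainAbstract
import Summits.HubbardSuperconductivity.HubbardSuperconductivity.Theorems.JosephsonMirrorFeynmanHellmann

/-!
# `JosephsonMirror.JmInterchange` (stmt-HubbardSuperconductivity-2227) is false WITHOUT Hubbard specifics —
negative-side support (lead c4): an explicit window double with pointwise-onset linear Josephson gain and NO floor bridge

Crux `JmInterchange` (rank 2 of route `JosephsonMirror`): uniform linear Josephson gain of the WINDOW DOUBLE
`H_L(J) = A ⊗ 1 + 1 ⊗ Aᵀ − J (D ⊗ D̄ + Dᴴ ⊗ D̄ᴴ)` (`D = L⁻¹ Δ`, `D̄ = (Dᴴ)ᵀ`) compressed to the window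
`S = (block 1 × block 1) ⊕ (block 2 × block 2)`, with onset `L₀ = L₀(J)` (`∀ J ∈ (0, J₀] ∃ L₀ ∀ L ≥ L₀:
a J L² ≤ E_L(0) − E_L(J)`), implies a ground-FLOOR pair bridge `a' L⁴ ≤ |⟨χ, Δ φ⟩|²` between the two blocks'
floors, eventually in `L`.  In the crux `A = hubbardTorusWith 2 L 1 U μ_L`, `Δ = pairField dWaveFormFactor L`, the
blocks are the sectors `(N_L, 0)`, `(N_L − 2, 0)`; the tree proves `JmInterchange ↔ (R1 ∧ R2′)` (p127245), both
residues being floor-level statements about the Hubbard torus at every doped `(U, δ)`.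

This file records, kernel-checked and with NO new definitions (the toy is file-local notation), that the IMPLICATION
SHAPE of the crux is false for abstract window doubles carrying every structural property the route's tools use —
Hermitian block-diagonal layer Hamiltonian, block-lowering pair operator with `‖Δ_L v‖² ≤ L⁴ ‖v‖²`, BALANCED floors
(the `μ_L` device), even SIMPLE floors ISOLATED by an `O(1)` gap (companion file), the exact Kronecker/window/
`minEnergyOn` packaging of the crux — so that any proof of `JmInterchange` must use a property of `hubbardTorus 2 L 1 U` that fails for the
toy below (strategist census `Cruxes/JmInterchange/STRATEGY-CENSUS.md` §5 N2, "`JmInterchange_false_without_HubbardSpecifics`").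

THE TOY (`ℂ⁴`, side `L`).  Layer states `e₀, e₁` (block 1, "`N`") and `e₂, e₃` (block 2, "`N − 2`");
`A = diag(0, 1, 0, 1)` (floors `e₀`, `e₂`, both at energy `0`, simple, gap `1`); pair operator
`Δ_L = L² |e₃⟩⟨e₁|` (lowers block 1 into block 2, `‖Δ_L‖ = L²`, and ANNIHILATES THE FLOOR `e₀`).
* `aw_gain` : `J L² − 2 ≤ E_L(0) − E_L(J)` for every `J ≥ 0`, `L ≥ 1` — the ordered EXCITED branch `(e₁, e₃)`
  (excess energy `1 + 1 = o(L²)`: zero-excess pair order, `‖Δ_L e₁‖² = L⁴`) phase-locks through the trial state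
  `(e₁ ⊗ e₁ + e₃ ⊗ e₃)/√2` (tree: `stub_gainAbstract`); hence `aw_gainHyp`: the crux's hypothesis holds with
  `a = 1/2` for EVERY `J > 0` once `J L ≥ 4` — onset `L₀(J) → ∞` as `J ↓ 0`;
* `aw_pairField_floor_eq_zero` : every floor vector `φ` of block 1 has `Δ_L φ = 0` — NO floor order and NO floor
  bridge at any `L` (the (R1)-failure shape: an order-free floor under an order-rich zero-excess branch, degenerate
  in energy DENSITY; Lieb–Seiringer–Yngvason's abstract "SSB without BEC" weight profile, Rep. Math. Phys. 59 (2007)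
  389, p. 9, in its smallest window-double form);
* `aw_minEnergyOn_block₁/₂` : BALANCED floors (both at `0`);
* `not_abstractWindowInterchange` : the crux's implication, abstracted over (index type, two disjoint blocks,
  Hermitian block-preserving `A`, block-lowering `Δ_L` with `‖Δ_L v‖² ≤ L⁴‖v‖²`, balanced floors) with hypothesis
  and conclusion spelled VERBATIM in the crux's `let`-vocabulary, is FALSE.
Companion file `AbstractWindowInterchangeProfile.lean`: the floors are SIMPLE and ISOLATED by the gap `1` (so fixed-scale
isolation does not rescue the fixed-`J` interchange — only the RATE form `rateFormInterchange`, p129634, does), the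
excited branch carries zero-excess pair order `‖Δ_L e₁‖² = L⁴`, and there is NO gain below the mesoscopic threshold
`J L² ≤ 2`: the gain profile is the retriage shape `max(0, J L² − 2)`, pointwise onset without uniform onset.

Consequence for new lines on stmt-2227 (and for the sibling interchange cruxes that met the same wall): a lever that
sees only these structures cannot separate the Hubbard torus from the toy; the missing input must be floor-level
information about `hubbardTorus 2 L 1 U` (census §0, §7).  Sources: E. H. Lieb, R. Seiringer, J. Yngvason,
Rep. Math. Phys. 59 (2007) 389 (the open converse and its abstract obstruction); T. Koma, H. Tasaki, J. Stat. Phys. 76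
(1994) 745; H. Tasaki, J. Stat. Phys. 174 (2019) 735 §5; E. H. Lieb, PRL 62 (1989) 1201 (the `W`-matrix packaging).
Elementary finite-dimensional linear algebra over the landed `stub_gainAbstract`. [folklore]
-/

noncomputable section

namespace Summit.HubbardSuperconductivity.JmInterchangeNegative

open Matrix Literature.MathematicalPhysics.QuantumLattice
open Summit.HubbardSuperconductivity.HubbardSuperconductivity.Theorems.JosephsonMirror

/-- Toy layer Hamiltonian `diag(0, 1, 0, 1)` on `ℂ⁴`. -/
local notation "awA" => (Matrix.diagonal ![(0 : ℂ), 1, 0, 1] : Matrix (Fin 4) (Fin 4) ℂ)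
/-- Toy pair operator at side `L`: `Δ_L = L² |e₃⟩⟨e₁|`. -/
local notation "awΔ[" L "]" => (Matrix.single (3 : Fin 4) (1 : Fin 4) (((L : ℕ) : ℂ) ^ 2) : Matrix (Fin 4) (Fin 4) ℂ)
/-- Block 1 ("sector `N`"): coordinates `0, 1`. -/
local notation "awP₁" => (fun s : Fin 4 => (s : ℕ) < 2)
/-- Block 2 ("sector `N − 2`"): coordinates `2, 3`. -/
local notation "awP₂" => (fun s : Fin 4 => 2 ≤ (s : ℕ))
/-- Block-1 subspace. -/
local notation "awK₁" => (⨅ (s : Fin 4) (_ : ¬ (s : ℕ) < 2),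
  LinearMap.ker (LinearMap.proj (R := ℂ) (φ := fun _ : Fin 4 => ℂ) s) : Submodule ℂ (Fin 4 → ℂ))
/-- Block-2 subspace. -/
local notation "awK₂" => (⨅ (s : Fin 4) (_ : ¬ 2 ≤ (s : ℕ)),
  LinearMap.ker (LinearMap.proj (R := ℂ) (φ := fun _ : Fin 4 => ℂ) s) : Submodule ℂ (Fin 4 → ℂ))

/-! ### The layer: Hermiticity, Rayleigh quotient, blocks, floors -/

/-- The toy layer Hamiltonian is Hermitian (real diagonal). [folklore] -/
theorem aw_isHermitian : (awA).IsHermitian := by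
  rw [Matrix.IsHermitian, Matrix.diagonal_conjTranspose]
  congr 1
  ext i
  fin_cases i <;> simp

/-- Action of the toy layer Hamiltonian. [folklore] -/
theorem aw_mulVec (v : Fin 4 → ℂ) : awA *ᵥ v = ![0, v 1, 0, v 3] := by
  ext i
  fin_cases i <;> simp [Matrix.mulVec_diagonal]

/-- Rayleigh quotient of the toy layer Hamiltonian: `Re⟨v, A v⟩ = |v 1|² + |v 3|²`. [folklore] -/
theorem aw_re_rayleigh (v : Fin 4 → ℂ) : (star v ⬝ᵥ awA *ᵥ v).re = ‖v 1‖ ^ 2 + ‖v 3‖ ^ 2 := by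
  rw [aw_mulVec, Complex.sq_norm, Complex.sq_norm, Complex.normSq_apply, Complex.normSq_apply]
  simp [dotProduct, Fin.sum_univ_four, Complex.mul_re]

/-- `‖v‖² = Σ |v i|²` on `ℂ⁴`. [folklore] -/
theorem aw_re_star_dotProduct_self (v : Fin 4 → ℂ) :
    (star v ⬝ᵥ v).re = ‖v 0‖ ^ 2 + ‖v 1‖ ^ 2 + ‖v 2‖ ^ 2 + ‖v 3‖ ^ 2 := by
  simp only [Complex.sq_norm, Complex.normSq_apply]
  simp [dotProduct, Fin.sum_univ_four, Complex.mul_re]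

/-- The toy layer Hamiltonian is nonnegative: `0 ≤ Re⟨v, A v⟩`. [folklore] -/
theorem aw_rayleigh_nonneg (v : Fin 4 → ℂ) : 0 ≤ (star v ⬝ᵥ awA *ᵥ v).re := by
  rw [aw_re_rayleigh]; positivity

/-- Membership in the block-1 subspace: support in `{0, 1}`. [folklore] -/
theorem aw_mem_K₁ (v : Fin 4 → ℂ) : v ∈ awK₁ ↔ ∀ s : Fin 4, ¬ (s : ℕ) < 2 → v s = 0 := by
  simp only [Submodule.mem_iInf, LinearMap.mem_ker, LinearMap.proj_apply]

/-- Membership in the block-2 subspace: support in `{2, 3}`. [folklore] -/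
theorem aw_mem_K₂ (v : Fin 4 → ℂ) : v ∈ awK₂ ↔ ∀ s : Fin 4, ¬ 2 ≤ (s : ℕ) → v s = 0 := by
  simp only [Submodule.mem_iInf, LinearMap.mem_ker, LinearMap.proj_apply]

/-- The toy layer Hamiltonian preserves block 1 (it is diagonal). [folklore] -/
theorem aw_mulVec_mem_K₁ {v : Fin 4 → ℂ} (hv : v ∈ awK₁) : awA *ᵥ v ∈ awK₁ := by
  rw [aw_mem_K₁] at hv ⊢
  intro s hs
  rw [aw_mulVec]
  fin_cases s
  · exact absurd (by decide) hs
  · exact absurd (by decide) hs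
  · rfl
  · exact hv 3 (by decide)

/-- The toy layer Hamiltonian preserves block 2. [folklore] -/
theorem aw_mulVec_mem_K₂ {v : Fin 4 → ℂ} (hv : v ∈ awK₂) : awA *ᵥ v ∈ awK₂ := by
  rw [aw_mem_K₂] at hv ⊢
  intro s hs
  rw [aw_mulVec]
  fin_cases s
  · rfl
  · exact hv 1 (by decide)
  · exact absurd (by decide) hs
  · exact absurd (by decide) hs

/-- The unit vector `e_i` has Rayleigh quotient `A i i`. [folklore] -/
theorem aw_re_rayleigh_single (i : Fin 4) :
    (star (Pi.single i (1 : ℂ)) ⬝ᵥ awA *ᵥ Pi.single i (1 : ℂ)).re = ‖(![(0 : ℂ), 1, 0, 1]) i‖ ^ 2 := by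
  rw [aw_re_rayleigh]
  fin_cases i <;> simp

/-- `e_i` is a unit vector. [folklore] -/
theorem aw_single_unit (i : Fin 4) : star (Pi.single i (1 : ℂ)) ⬝ᵥ Pi.single i (1 : ℂ) = 1 := by
  rw [← Pi.single_star, star_one, single_dotProduct, one_mul, Pi.single_eq_same]

/-- `e₀, e₁` lie in block 1. [folklore] -/
theorem aw_single_mem_K₁ {i : Fin 4} (hi : (i : ℕ) < 2) : Pi.single i (1 : ℂ) ∈ awK₁ := by
  rw [aw_mem_K₁]
  intro s hs
  rw [Pi.single_apply, if_neg]
  rintro rfl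
  exact hs hi

/-- `e₂, e₃` lie in block 2. [folklore] -/
theorem aw_single_mem_K₂ {i : Fin 4} (hi : 2 ≤ (i : ℕ)) : Pi.single i (1 : ℂ) ∈ awK₂ := by
  rw [aw_mem_K₂]
  intro s hs
  rw [Pi.single_apply, if_neg]
  rintro rfl
  exact hs hi

/-- Lower bound for a sector energy from a uniform Rayleigh lower bound (the Rayleigh set is nonempty as soon as the
sector contains a unit vector). [folklore] -/
theorem aw_le_minEnergyOn {n : Type*} [Fintype n] (A : Matrix n n ℂ) (K : Submodule ℂ (n → ℂ)) {b : ℝ}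
    {ψ₀ : n → ℂ} (hψ₀ : ψ₀ ∈ K) (hψ₀1 : star ψ₀ ⬝ᵥ ψ₀ = 1)
    (h : ∀ ψ ∈ K, star ψ ⬝ᵥ ψ = 1 → b ≤ (star ψ ⬝ᵥ A *ᵥ ψ).re) : b ≤ A.minEnergyOn K := by
  refine le_csInf ⟨_, ψ₀, hψ₀, hψ₀1, rfl⟩ ?_
  rintro E ⟨ψ, hψ, hψ1, rfl⟩
  exact h ψ hψ hψ1

/-- BALANCED FLOORS, block 1: `minEnergyOn A K₁ = 0` (nonnegativity and the floor `e₀`). [folklore] -/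
theorem aw_minEnergyOn_block₁ : (awA).minEnergyOn awK₁ = 0 := by
  refine le_antisymm ?_ ?_
  · have h := minEnergyOn_le_rayleigh_of_mem aw_isHermitian awK₁ (aw_single_mem_K₁ (i := 0) (by decide))
      (aw_single_unit 0)
    rw [aw_re_rayleigh_single] at h
    simpa using h
  · exact aw_le_minEnergyOn _ _ (aw_single_mem_K₁ (i := 0) (by decide)) (aw_single_unit 0)
      fun ψ _ _ => aw_rayleigh_nonneg ψ

/-- BALANCED FLOORS, block 2: `minEnergyOn A K₂ = 0` (nonnegativity and the floor `e₂`). [folklore] -/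
theorem aw_minEnergyOn_block₂ : (awA).minEnergyOn awK₂ = 0 := by
  refine le_antisymm ?_ ?_
  · have h := minEnergyOn_le_rayleigh_of_mem aw_isHermitian awK₂ (aw_single_mem_K₂ (i := 2) (by decide))
      (aw_single_unit 2)
    rw [aw_re_rayleigh_single] at h
    simpa using h
  · exact aw_le_minEnergyOn _ _ (aw_single_mem_K₂ (i := 2) (by decide)) (aw_single_unit 2)
      fun ψ _ _ => aw_rayleigh_nonneg ψ

/-! ### The pair operator: lowering, norm, and the order-free floor -/

/-- Action of the toy pair operator: `Δ_L v = L² v₁ e₃`. [folklore] -/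
theorem aw_pairField_mulVec (L : ℕ) (v : Fin 4 → ℂ) :
    awΔ[L] *ᵥ v = (((L : ℂ)) ^ 2 * v 1) • Pi.single (3 : Fin 4) (1 : ℂ) :=
  Matrix.single_mulVec_eq _ _ _ _

/-- The toy pair operator lowers block 1 into block 2. [folklore] -/
theorem aw_pairField_mulVec_mem_K₂ (L : ℕ) (v : Fin 4 → ℂ) : awΔ[L] *ᵥ v ∈ awK₂ := by
  rw [aw_pairField_mulVec]
  exact Submodule.smul_mem _ _ (aw_single_mem_K₂ (i := 3) (by decide))

/-- Norm bound `‖Δ_L v‖² ≤ L⁴ ‖v‖²` (the toy analogue of `‖Δ_d‖ ≤ C L²`). [folklore] -/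
theorem aw_pairField_norm_le (L : ℕ) (v : Fin 4 → ℂ) :
    (star (awΔ[L] *ᵥ v) ⬝ᵥ (awΔ[L] *ᵥ v)).re ≤ (L : ℝ) ^ 4 * (star v ⬝ᵥ v).re := by
  rw [aw_pairField_mulVec, star_smul, smul_dotProduct, dotProduct_smul, aw_single_unit, aw_re_star_dotProduct_self]
  simp only [smul_eq_mul, mul_one]
  have h : (star (((L : ℂ)) ^ 2 * v 1) * (((L : ℂ)) ^ 2 * v 1)).re = (L : ℝ) ^ 4 * ‖v 1‖ ^ 2 := by
    rw [Complex.star_def, Complex.conj_mul', ← Complex.ofReal_pow, Complex.ofReal_re, norm_mul, norm_pow,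
      Complex.norm_natCast]
    ring
  rw [h]
  nlinarith [sq_nonneg ‖v 0‖, sq_nonneg ‖v 2‖, sq_nonneg ‖v 3‖, pow_nonneg (Nat.cast_nonneg (α := ℝ) L) 4,
    mul_nonneg (pow_nonneg (Nat.cast_nonneg (α := ℝ) L) 4)
      (add_nonneg (add_nonneg (sq_nonneg ‖v 0‖) (sq_nonneg ‖v 2‖)) (sq_nonneg ‖v 3‖))]

/-- THE ORDER-FREE FLOOR: every floor vector of block 1 (indeed every eigenvector of `A` at the block-1 floor energy
`0`) is annihilated by the pair operator, `Δ_L φ = 0` — no floor order, and no floor bridge to ANY vector. [folklore] -/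
theorem aw_pairField_floor_eq_zero (L : ℕ) {φ : Fin 4 → ℂ}
    (hAφ : awA *ᵥ φ = (((awA).minEnergyOn awK₁ : ℝ) : ℂ) • φ) : awΔ[L] *ᵥ φ = 0 := by
  rw [aw_minEnergyOn_block₁, Complex.ofReal_zero, zero_smul, aw_mulVec] at hAφ
  have h1 : φ 1 = 0 := by
    have := congrFun hAφ 1
    simpa using this
  rw [aw_pairField_mulVec, h1, mul_zero, zero_smul]

/-! ### The window double: linear Josephson gain with pointwise onset -/

/-- **Linear Josephson gain of the toy window double**: for `J ≥ 0` and `L ≥ 1`,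
`J L² − 2 ≤ E_L(0) − E_L(J)`, `E_L(J) = minEnergyOn` of `A ⊗ 1 + 1 ⊗ Aᵀ − J (D ⊗ D̄ + Dᴴ ⊗ D̄ᴴ)` (`D = L⁻¹ Δ_L`)
on the window `S` — by the tree's trial-pair bound `stub_gainAbstract` with the EXCITED pair `(e₁, e₃)`:
`|⟨e₃, D e₁⟩|² = L²`, excesses `1` and `1`. [folklore] -/
theorem aw_gain (L : ℕ) [NeZero L] {J : ℝ} (hJ : 0 ≤ J) :
    (let D : Matrix (Fin 4) (Fin 4) ℂ := ((L : ℂ))⁻¹ • awΔ[L]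
     let Hd : ℝ → Matrix (Fin 4 × Fin 4) (Fin 4 × Fin 4) ℂ := fun J =>
       Matrix.kroneckerMap (fun a b : ℂ => a * b) awA 1 +
         Matrix.kroneckerMap (fun a b : ℂ => a * b) 1 (Matrix.transpose awA) -
         (J : ℂ) • (Matrix.kroneckerMap (fun a b : ℂ => a * b) D (Matrix.transpose (Matrix.conjTranspose D)) +
           Matrix.kroneckerMap (fun a b : ℂ => a * b) (Matrix.conjTranspose D) (Matrix.transpose D))
     let good : Fin 4 × Fin 4 → Prop := fun p =>
       ((p.1 : ℕ) < 2 ∧ (p.2 : ℕ) < 2) ∨ (2 ≤ (p.1 : ℕ) ∧ 2 ≤ (p.2 : ℕ))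
     let S : Submodule ℂ (Fin 4 × Fin 4 → ℂ) := ⨅ (p : Fin 4 × Fin 4) (_ : ¬ good p),
       LinearMap.ker (LinearMap.proj (R := ℂ) (φ := fun _ : Fin 4 × Fin 4 => ℂ) p)
     let E : ℝ → ℝ := fun J => (Hd J).minEnergyOn S
     J * (L : ℝ) ^ 2 - 2 ≤ E 0 - E J) := by
  intro D Hd good S E
  have hS : ∀ ψ, ψ ∈ S ↔ ∀ p, ¬ good p → ψ p = 0 := by
    intro ψ
    simp only [S, Submodule.mem_iInf, LinearMap.mem_ker, LinearMap.proj_apply]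
  have h12 : ∀ s : Fin 4, (s : ℕ) < 2 → ¬ 2 ≤ (s : ℕ) := fun s hs => by omega
  have hgood : ∀ s t : Fin 4, good (s, t) → ((s : ℕ) < 2 ∧ (t : ℕ) < 2) ∨ (2 ≤ (s : ℕ) ∧ 2 ≤ (t : ℕ)) :=
    fun s t h => h
  have hgood₁ : ∀ s t : Fin 4, (s : ℕ) < 2 → (t : ℕ) < 2 → good (s, t) := fun s t hs ht => Or.inl ⟨hs, ht⟩
  have hgood₂ : ∀ s t : Fin 4, 2 ≤ (s : ℕ) → 2 ≤ (t : ℕ) → good (s, t) := fun s t hs ht => Or.inr ⟨hs, ht⟩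
  have hA₁ : ∀ v : Fin 4 → ℂ, (∀ s : Fin 4, ¬ (s : ℕ) < 2 → v s = 0) →
      (0 : ℝ) * (star v ⬝ᵥ v).re ≤ (star v ⬝ᵥ (awA).mulVec v).re := fun v _ => by
    rw [zero_mul]; exact aw_rayleigh_nonneg v
  have hA₂ : ∀ v : Fin 4 → ℂ, (∀ s : Fin 4, ¬ 2 ≤ (s : ℕ) → v s = 0) →
      (0 : ℝ) * (star v ⬝ᵥ v).re ≤ (star v ⬝ᵥ (awA).mulVec v).re := fun v _ => by
    rw [zero_mul]; exact aw_rayleigh_nonneg v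
  have huP : ∀ s : Fin 4, ¬ (s : ℕ) < 2 → (Pi.single (1 : Fin 4) (1 : ℂ) : Fin 4 → ℂ) s = 0 :=
    (aw_mem_K₁ _).1 (aw_single_mem_K₁ (i := 1) (by decide))
  have hwP : ∀ s : Fin 4, ¬ 2 ≤ (s : ℕ) → (Pi.single (3 : Fin 4) (1 : ℂ) : Fin 4 → ℂ) s = 0 :=
    (aw_mem_K₂ _).1 (aw_single_mem_K₂ (i := 3) (by decide))
  have key := stub_gainAbstract awA D aw_isHermitian awP₁ awP₂ h12 good hgood hgood₁ hgood₂ S hS 0 hA₁ hA₂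
    (Pi.single (1 : Fin 4) (1 : ℂ)) (Pi.single (3 : Fin 4) (1 : ℂ)) huP hwP (aw_single_unit 1) (aw_single_unit 3) hJ
  -- evaluate the three numbers on the left
  have hL : (L : ℂ) ≠ 0 := Nat.cast_ne_zero.2 (NeZero.ne L)
  have hmat : star (Pi.single (3 : Fin 4) (1 : ℂ)) ⬝ᵥ D.mulVec (Pi.single (1 : Fin 4) (1 : ℂ)) = (L : ℂ) := by
    show star (Pi.single (3 : Fin 4) (1 : ℂ)) ⬝ᵥ ((((L : ℂ))⁻¹ • awΔ[L]) *ᵥ Pi.single (1 : Fin 4) (1 : ℂ)) = (L : ℂ)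
    rw [smul_mulVec, aw_pairField_mulVec, Pi.single_eq_same, mul_one, dotProduct_smul, dotProduct_smul,
      aw_single_unit]
    simp only [smul_eq_mul, mul_one]
    field_simp
  have hu : (star (Pi.single (1 : Fin 4) (1 : ℂ)) ⬝ᵥ (awA).mulVec (Pi.single (1 : Fin 4) (1 : ℂ))).re = 1 := by
    rw [aw_re_rayleigh]
    simp
  have hw : (star (Pi.single (3 : Fin 4) (1 : ℂ)) ⬝ᵥ (awA).mulVec (Pi.single (3 : Fin 4) (1 : ℂ))).re = 1 := by
    rw [aw_re_rayleigh]
    simp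
  rw [hmat, hu, hw, Complex.norm_natCast] at key
  have h2 : J * (L : ℝ) ^ 2 - 2 = J * (L : ℝ) ^ 2 - (1 - 0) - (1 - 0) := by ring
  rw [h2]
  exact key

/-- **The crux's HYPOTHESIS holds for the toy, for every `J₀`** (pointwise onset): for every `J > 0` there is `L₀`
(any `L₀ ≥ 4/J`) with `(1/2) J L² ≤ E_L(0) − E_L(J)` for all `L ≥ L₀` — `GainHyp` with `a = 1/2`; the onset
`L₀(J) ↑ ∞` as `J ↓ 0` is genuine: below the mesoscopic threshold `J L² ≤ 2` there is no gain at all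
(`aw_noGain_of_small`, companion file `AbstractWindowInterchangeProfile.lean`). [folklore] -/
theorem aw_gainHyp {J : ℝ} (hJ : 0 < J) :
    ∃ L₀ : ℕ, ∀ (L : ℕ) [NeZero L], Even L → L₀ ≤ L →
      (let D : Matrix (Fin 4) (Fin 4) ℂ := ((L : ℂ))⁻¹ • awΔ[L]
       let Hd : ℝ → Matrix (Fin 4 × Fin 4) (Fin 4 × Fin 4) ℂ := fun J =>
         Matrix.kroneckerMap (fun a b : ℂ => a * b) awA 1 +
           Matrix.kroneckerMap (fun a b : ℂ => a * b) 1 (Matrix.transpose awA) -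
           (J : ℂ) • (Matrix.kroneckerMap (fun a b : ℂ => a * b) D (Matrix.transpose (Matrix.conjTranspose D)) +
             Matrix.kroneckerMap (fun a b : ℂ => a * b) (Matrix.conjTranspose D) (Matrix.transpose D))
       let good : Fin 4 × Fin 4 → Prop := fun p =>
         ((p.1 : ℕ) < 2 ∧ (p.2 : ℕ) < 2) ∨ (2 ≤ (p.1 : ℕ) ∧ 2 ≤ (p.2 : ℕ))
       let S : Submodule ℂ (Fin 4 × Fin 4 → ℂ) := ⨅ (p : Fin 4 × Fin 4) (_ : ¬ good p),
         LinearMap.ker (LinearMap.proj (R := ℂ) (φ := fun _ : Fin 4 × Fin 4 => ℂ) p)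
       let E : ℝ → ℝ := fun J => (Hd J).minEnergyOn S
       (1 / 2 : ℝ) * J * (L : ℝ) ^ 2 ≤ E 0 - E J) := by
  refine ⟨⌈4 / J⌉₊, fun L _ _ hL => ?_⟩
  have hgain := aw_gain L hJ.le
  have hL1 : (1 : ℝ) ≤ L := by exact_mod_cast Nat.one_le_iff_ne_zero.2 (NeZero.ne L)
  have hLJ : 4 / J ≤ (L : ℝ) := (Nat.le_ceil _).trans (by exact_mod_cast hL)
  have h4 : 4 ≤ J * (L : ℝ) := by
    rw [div_le_iff₀ hJ] at hLJ
    linarith [hLJ]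
  have h4' : 4 ≤ J * (L : ℝ) ^ 2 := by nlinarith
  refine le_trans ?_ hgain
  linarith

/-! ### The packaged negative statement -/

/-- **`JmInterchange` is false without Hubbard specifics.**  The ABSTRACT WINDOW INTERCHANGE — for an index type
with two disjoint blocks `P₁, P₂`, a Hermitian layer Hamiltonian `A` preserving both blocks with BALANCED floors
(`minEnergyOn A K₁ = minEnergyOn A K₂`, the `μ_L` device), and block-lowering pair operators `Δ_L` with
`‖Δ_L v‖² ≤ L⁴‖v‖²`: "pointwise-onset linear Josephson gain of the window double
`A ⊗ 1 + 1 ⊗ Aᵀ − J (D ⊗ D̄ + Dᴴ ⊗ D̄ᴴ)`, `D = L⁻¹Δ_L`, on the window `S` ⇒ eventually a floor pair `(φ, χ)` with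
`a' L⁴ ≤ |⟨χ, Δ_L φ⟩|²`" (hypothesis and conclusion spelled as in the crux) — is FALSE: the toy `A = diag(0,1,0,1)`,
`Δ_L = L²|e₃⟩⟨e₁|` satisfies every hypothesis with `a = 1/2`, `J₀ = 1` (`aw_gainHyp`) while every block-1 floor
vector is annihilated by `Δ_L` (`aw_pairField_floor_eq_zero`).  Hence any proof of the crux must use a property of
`hubbardTorus 2 L 1 U` / `pairField dWaveFormFactor L` that fails here. [folklore] -/
theorem not_abstractWindowInterchange :
    ¬ ∀ (ι : Type) [Fintype ι] [DecidableEq ι] (P₁ P₂ : ι → Prop) (A : Matrix ι ι ℂ)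
        (Δ : ℕ → Matrix ι ι ℂ) (a J₀ : ℝ),
        A.IsHermitian → (∀ s, P₁ s → ¬ P₂ s) → 0 < a → 0 < J₀ →
        (let K₁ : Submodule ℂ (ι → ℂ) := ⨅ (s : ι) (_ : ¬ P₁ s),
           LinearMap.ker (LinearMap.proj (R := ℂ) (φ := fun _ : ι => ℂ) s)
         let K₂ : Submodule ℂ (ι → ℂ) := ⨅ (s : ι) (_ : ¬ P₂ s),
           LinearMap.ker (LinearMap.proj (R := ℂ) (φ := fun _ : ι => ℂ) s)
         (∀ v ∈ K₁, A *ᵥ v ∈ K₁) ∧ (∀ v ∈ K₂, A *ᵥ v ∈ K₂) ∧ (∀ L, ∀ v ∈ K₁, Δ L *ᵥ v ∈ K₂) ∧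
           A.minEnergyOn K₁ = A.minEnergyOn K₂ ∧
           (∀ (L : ℕ) (v : ι → ℂ), (star (Δ L *ᵥ v) ⬝ᵥ (Δ L *ᵥ v)).re ≤ (L : ℝ) ^ 4 * (star v ⬝ᵥ v).re)) →
        (∀ J ∈ Set.Ioc (0 : ℝ) J₀, ∃ L₀ : ℕ, ∀ (L : ℕ) [NeZero L], Even L → L₀ ≤ L →
          (let D : Matrix ι ι ℂ := ((L : ℂ))⁻¹ • Δ L
           let Hd : ℝ → Matrix (ι × ι) (ι × ι) ℂ := fun J =>
             Matrix.kroneckerMap (fun a b : ℂ => a * b) A 1 +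
               Matrix.kroneckerMap (fun a b : ℂ => a * b) 1 (Matrix.transpose A) -
               (J : ℂ) • (Matrix.kroneckerMap (fun a b : ℂ => a * b) D (Matrix.transpose (Matrix.conjTranspose D)) +
                 Matrix.kroneckerMap (fun a b : ℂ => a * b) (Matrix.conjTranspose D) (Matrix.transpose D))
           let good : ι × ι → Prop := fun p => (P₁ p.1 ∧ P₁ p.2) ∨ (P₂ p.1 ∧ P₂ p.2)
           let S : Submodule ℂ (ι × ι → ℂ) := ⨅ (p : ι × ι) (_ : ¬ good p),
             LinearMap.ker (LinearMap.proj (R := ℂ) (φ := fun _ : ι × ι => ℂ) p)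
           let E : ℝ → ℝ := fun J => (Hd J).minEnergyOn S
           a * J * (L : ℝ) ^ 2 ≤ E 0 - E J)) →
        ∃ a' : ℝ, 0 < a' ∧ ∃ L₀ : ℕ, ∀ (L : ℕ) [NeZero L], Even L → L₀ ≤ L →
          ∃ φ χ : ι → ℂ,
            (let K₁ : Submodule ℂ (ι → ℂ) := ⨅ (s : ι) (_ : ¬ P₁ s),
               LinearMap.ker (LinearMap.proj (R := ℂ) (φ := fun _ : ι => ℂ) s)
             φ ∈ K₁ ∧ φ ≠ 0 ∧ A *ᵥ φ = ((A.minEnergyOn K₁ : ℝ) : ℂ) • φ) ∧ star φ ⬝ᵥ φ = 1 ∧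
            (let K₂ : Submodule ℂ (ι → ℂ) := ⨅ (s : ι) (_ : ¬ P₂ s),
               LinearMap.ker (LinearMap.proj (R := ℂ) (φ := fun _ : ι => ℂ) s)
             χ ∈ K₂ ∧ χ ≠ 0 ∧ A *ᵥ χ = ((A.minEnergyOn K₂ : ℝ) : ℂ) • χ) ∧ star χ ⬝ᵥ χ = 1 ∧
            a' * (L : ℝ) ^ 4 ≤ ‖star χ ⬝ᵥ (Δ L *ᵥ φ)‖ ^ 2 := by
  intro h
  have hstruct : (∀ v ∈ awK₁, awA *ᵥ v ∈ awK₁) ∧ (∀ v ∈ awK₂, awA *ᵥ v ∈ awK₂) ∧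
      (∀ L, ∀ v ∈ awK₁, awΔ[L] *ᵥ v ∈ awK₂) ∧ (awA).minEnergyOn awK₁ = (awA).minEnergyOn awK₂ ∧
      (∀ (L : ℕ) (v : Fin 4 → ℂ),
        (star (awΔ[L] *ᵥ v) ⬝ᵥ (awΔ[L] *ᵥ v)).re ≤ (L : ℝ) ^ 4 * (star v ⬝ᵥ v).re) :=
    ⟨fun v hv => aw_mulVec_mem_K₁ hv, fun v hv => aw_mulVec_mem_K₂ hv, fun L v _ => aw_pairField_mulVec_mem_K₂ L v,
      by rw [aw_minEnergyOn_block₁, aw_minEnergyOn_block₂], aw_pairField_norm_le⟩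
  have hgain : ∀ J ∈ Set.Ioc (0 : ℝ) 1, ∃ L₀ : ℕ, ∀ (L : ℕ) [NeZero L], Even L → L₀ ≤ L →
      (let D : Matrix (Fin 4) (Fin 4) ℂ := ((L : ℂ))⁻¹ • awΔ[L]
       let Hd : ℝ → Matrix (Fin 4 × Fin 4) (Fin 4 × Fin 4) ℂ := fun J =>
         Matrix.kroneckerMap (fun a b : ℂ => a * b) awA 1 +
           Matrix.kroneckerMap (fun a b : ℂ => a * b) 1 (Matrix.transpose awA) -
           (J : ℂ) • (Matrix.kroneckerMap (fun a b : ℂ => a * b) D (Matrix.transpose (Matrix.conjTranspose D)) +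
             Matrix.kroneckerMap (fun a b : ℂ => a * b) (Matrix.conjTranspose D) (Matrix.transpose D))
       let good : Fin 4 × Fin 4 → Prop := fun p =>
         ((p.1 : ℕ) < 2 ∧ (p.2 : ℕ) < 2) ∨ (2 ≤ (p.1 : ℕ) ∧ 2 ≤ (p.2 : ℕ))
       let S : Submodule ℂ (Fin 4 × Fin 4 → ℂ) := ⨅ (p : Fin 4 × Fin 4) (_ : ¬ good p),
         LinearMap.ker (LinearMap.proj (R := ℂ) (φ := fun _ : Fin 4 × Fin 4 => ℂ) p)
       let E : ℝ → ℝ := fun J => (Hd J).minEnergyOn S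
       (1 / 2 : ℝ) * J * (L : ℝ) ^ 2 ≤ E 0 - E J) := fun J hJ => aw_gainHyp hJ.1
  obtain ⟨a', ha', L₀, hL₀⟩ := h (Fin 4) awP₁ awP₂ awA (fun L => awΔ[L]) (1 / 2) 1 aw_isHermitian
    (fun s hs => by omega) (by norm_num) one_pos hstruct hgain
  -- read the conclusion at the even side `L = 2 L₀ + 2`
  haveI : NeZero (2 * L₀ + 2) := ⟨by omega⟩
  obtain ⟨φ, χ, ⟨-, -, hAφ⟩, -, -, -, hbridge⟩ := hL₀ (2 * L₀ + 2) ⟨L₀ + 1, by ring⟩ (by omega)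
  have h0 : awΔ[2 * L₀ + 2] *ᵥ φ = 0 := aw_pairField_floor_eq_zero (2 * L₀ + 2) hAφ
  rw [h0, dotProduct_zero, norm_zero, zero_pow two_ne_zero] at hbridge
  have : (0 : ℝ) < a' * ((2 * L₀ + 2 : ℕ) : ℝ) ^ 4 := by positivity
  linarith

end Summit.HubbardSuperconductivity.JmInterchangeNegative

end

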